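import Mathlib
import Summits.NavierStokesRegularity.NavierStokesRegularity.Theorems.EulerZoomLiouvillePowerGaugeEulerLiouvilleSwirlCapacityPlaneCapacity
import Summits.NavierStokesRegularity.NavierStokesRegularity.Theorems.EulerZoomLiouvillePowerGaugeEulerLiouvilleSwirlCapacityAxisFloorMeridional
import Literature.Analysis.FluidPDE.AxisymmetricEuler
import HarnessLib.Audit

/-!
# Crux `EulerZoomLiouville.PowerGaugeEulerLiouville` (stmt-NavierStokesRegularity-19832), line `swirl-capacity`:
# STUB D2 IN ITS REGISTERED LOG-SHARP FORM — THE AXIS CAPACITY FLOOR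

Route №10 `EulerZoomLiouville` (NavierStokesRegularity), crux E.  Line `swirl-capacity` (ideator ns-idea-11 g3;
`Cruxes/PowerGaugeEulerLiouville/Lines/swirl_capacity.lean`), registered stub `stub_axisCapacityFloor` = `Sig.stub_axisCapacityFloor := AxisCapacityFloor`:
an axisymmetric `C¹` scalar `f` vanishing on the symmetry axis with `f ≥ γ₀` on a measurable `T ⊆ B(0,A)` of volume `≥ V` has
`∫_{B(0,3A)} ‖∇f‖²/r² ≥ K γ₀² / (A (1 + log⁺(A³/V)))` for a universal `K > 0` — here `K = π²/(18 (3 + log (288 π²)))`.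
(The power-lossy form `axisCapacityFloorPow`, ns-cas-k2 g0, is in the tree and already closes the line's race; this file discharges the
REGISTERED statement, strictly stronger, against which D2' `swirlCapacityFloor_of_axisCapacityFloor` and D3
`vanishesAE_of_swirlCapacityFloor_of_swirlBlobsPersist` were landed.)

PROOF (elementary potential theory; no condenser theory, no rearrangement, no cut-off): `sector_ray_bound` = FTC along the downward fan
`θ ∈ (−2π/3, −π/3)` from `y` to the axis where the meridional profile vanishes, averaged and rewritten in polar coordinates; then the
planar capacity inequality `lintegral_sq_ge_of_ray_bound` (tools 2–4) on the meridional section of the superlevel cylinder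
(ns-cas-k2's `volume_le_meridional_section`), and ns-cas-k2's `meridional_energy_le` to return to `∫ ‖∇f‖²/r²`.
WHAT THIS IS NOT: not NS regularity, not the crux E — a `--supports` helper for stmt-19832 (pure real analysis); the line's residue D4 and
19832 stay OPEN.  [folklore; cf. Mazja1985 §2.2.3 (6) (the sharp planar capacity–area inequality)]
-/

noncomputable section

-- flat `Theorems/<Route><Decl>…` files of one crux share the namespace of the crux (tree convention)
set_option linter.dupNamespace false

open MeasureTheory Set Filter Topology Metric Function Real
open scoped NNReal ENNReal

namespace Summit.NavierStokesRegularity.NavierStokesRegularity.Theorems.PowerGaugeEulerLiouville.SwirlCapacity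

open Literature.Analysis Literature.Analysis.FluidPDE

/-! ### The sector ray bound from the grounded axis -/

/-- Directions of the downward fan: for `θ ∈ (−2π/3, −π/3)`, `|cos θ| ≤ 1/2` and `sin θ ≤ −1/2`. [folklore] -/
theorem fan_trig {θ : ℝ} (hθ : θ ∈ Ioo (-(2 * π / 3)) (-(π / 3))) : |Real.cos θ| ≤ 1 / 2 ∧ Real.sin θ ≤ -(1 / 2) := by
  obtain ⟨h1, h2⟩ := hθ
  have hπ := Real.pi_pos
  have hc1 : Real.cos θ ≤ 1 / 2 := by
    rw [← Real.cos_neg, ← Real.cos_pi_div_three]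
    exact Real.cos_le_cos_of_nonneg_of_le_pi (by positivity) (by linarith) (by linarith)
  have hc2 : -(1 / 2) ≤ Real.cos θ := by
    have h : Real.cos (π - π / 3) ≤ Real.cos (-θ) :=
      Real.cos_le_cos_of_nonneg_of_le_pi (by linarith) (by linarith) (by linarith)
    rw [Real.cos_pi_sub, Real.cos_pi_div_three, Real.cos_neg] at h
    linarith
  have hs : 0 < Real.sin (-θ) := Real.sin_pos_of_pos_of_lt_pi (by linarith) (by linarith)
  rw [Real.sin_neg] at hs
  refine ⟨abs_le.2 ⟨hc2, hc1⟩, ?_⟩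
  nlinarith [Real.sin_sq_add_cos_sq θ, abs_le.2 ⟨hc2, hc1⟩, sq_abs (Real.cos θ)]

/-- **THE SECTOR RAY BOUND FROM THE GROUNDED AXIS.**  Let `u ∈ C¹(ℂ; ℝ)` vanish on the real axis `im w = 0`, `A > 0`, and `y` with
`|re y| ≤ A`, `0 < im y ≤ A`.  Then `(π/3) |u(y)| ≤ ∫_{Box} ‖∇u(x)‖ |x − y|⁻¹ dA(x)` with `Box = {|re| ≤ 2A, 0 < im ≤ 2A}`:
FTC along each ray of the fan `θ ∈ (−2π/3, −π/3)` from `y` down to the axis (length `≤ 2 im y`, inside the box), then polar coordinates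
about `y`. [folklore] -/
theorem sector_ray_bound {u : ℂ → ℝ} (hu : ContDiff ℝ 1 u) (hax : ∀ w : ℂ, w.im = 0 → u w = 0) {A : ℝ} (hA : 0 < A)
    {y : ℂ} (hy1 : |y.re| ≤ A) (hy2 : 0 < y.im) (hy3 : y.im ≤ A) :
    ENNReal.ofReal (π / 3) * ‖u y‖ₑ ≤
      ∫⁻ x in {x : ℂ | x.re ∈ Icc (-(2 * A)) (2 * A) ∧ x.im ∈ Ioc 0 (2 * A)}, ‖fderiv ℝ u x‖ₑ * ENNReal.ofReal ‖x - y‖⁻¹ := by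
  set Box : Set ℂ := {x : ℂ | x.re ∈ Icc (-(2 * A)) (2 * A) ∧ x.im ∈ Ioc 0 (2 * A)} with hBox
  have hBoxm : MeasurableSet Box :=
    (measurableSet_Icc.preimage Complex.continuous_re.measurable).inter (measurableSet_Ioc.preimage Complex.continuous_im.measurable)
  set H : ℂ → ℝ≥0∞ := Box.indicator fun x => ‖fderiv ℝ u x‖ₑ with hH
  have hHm : Measurable H := ((hu.continuous_fderiv one_ne_zero).measurable.enorm).indicator hBoxm
  -- the integrand in polar coordinates about `y`
  set G : ℝ × ℝ → ℝ≥0∞ := fun p => H (y + p.1 * (Real.cos p.2 + Real.sin p.2 * Complex.I)) with hG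
  have hγc : Continuous fun p : ℝ × ℝ => y + (p.1 : ℂ) * (Real.cos p.2 + Real.sin p.2 * Complex.I) := by fun_prop
  have hGm : Measurable G := hHm.comp hγc.measurable
  -- step 1: along every ray of the fan
  have hray : ∀ θ ∈ Ioo (-(2 * π / 3)) (-(π / 3)), ‖u y‖ₑ ≤ ∫⁻ r in Ioi (0 : ℝ), G (r, θ) := by
    intro θ hθ
    obtain ⟨hcos, hsin⟩ := fan_trig hθ
    set v : ℂ := Real.cos θ + Real.sin θ * Complex.I with hv
    have hv1 : ‖v‖ = 1 := by
      have h := Complex.norm_cos_add_sin_mul_I θ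
      rwa [← Complex.ofReal_cos, ← Complex.ofReal_sin] at h
    -- the ray length to the axis
    set ℓ : ℝ := y.im / (-Real.sin θ) with hℓ
    have hs0 : 0 < -Real.sin θ := by linarith
    have hsne : Real.sin θ ≠ 0 := (show Real.sin θ < 0 by linarith).ne
    have hℓ0 : 0 < ℓ := div_pos hy2 hs0
    have hℓ2 : ℓ ≤ 2 * y.im := by
      rw [hℓ, div_le_iff₀ hs0]; nlinarith
    -- the restriction of `u` to the ray
    set g : ℝ → ℝ := fun r => u (y + (r : ℂ) * v) with hg
    have hγ : ∀ r : ℝ, HasDerivAt (fun r : ℝ => y + (r : ℂ) * v) v r := by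
      intro r
      have h := ((Complex.ofRealCLM.hasDerivAt (x := r)).mul_const v).const_add y
      simpa using h
    have hgd : ∀ r : ℝ, HasDerivAt g (fderiv ℝ u (y + (r : ℂ) * v) v) r := fun r =>
      (hu.differentiable one_ne_zero _).hasFDerivAt.comp_hasDerivAt r (hγ r)
    have hg'c : Continuous fun r : ℝ => fderiv ℝ u (y + (r : ℂ) * v) v :=
      ((hu.continuous_fderiv one_ne_zero).comp (by fun_prop : Continuous fun r : ℝ => y + (r : ℂ) * v)).clm_apply
        continuous_const
    -- the endpoint lies on the axis
    have hend : g ℓ = 0 := by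
      apply hax
      simp only [hv, Complex.add_im, Complex.mul_im, Complex.ofReal_re, Complex.ofReal_im, Complex.add_re, Complex.mul_re,
        Complex.I_re, Complex.I_im]
      rw [hℓ]
      field_simp
      ring
    -- FTC: `|u y| = |g 0| = |∫_0^ℓ g'| ≤ ∫_0^ℓ ‖∇u‖`
    have hFTC : ∫ r in (0 : ℝ)..ℓ, fderiv ℝ u (y + (r : ℂ) * v) v = g ℓ - g 0 :=
      intervalIntegral.integral_eq_sub_of_hasDerivAt (fun r _ => hgd r) (hg'c.intervalIntegrable _ _)
    have hg0 : g 0 = u y := by simp [hg]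
    have habs : |u y| ≤ ∫ r in (0 : ℝ)..ℓ, ‖fderiv ℝ u (y + (r : ℂ) * v)‖ := by
      have h1 : |u y| = |∫ r in (0 : ℝ)..ℓ, fderiv ℝ u (y + (r : ℂ) * v) v| := by
        rw [hFTC, hend, hg0, zero_sub, abs_neg]
      rw [h1]
      refine (intervalIntegral.abs_integral_le_integral_abs hℓ0.le).trans ?_
      refine intervalIntegral.integral_mono_on hℓ0.le (hg'c.abs.intervalIntegrable _ _)
        (((hu.continuous_fderiv one_ne_zero).comp (by fun_prop : Continuous fun r : ℝ => y + (r : ℂ) * v)).norm.intervalIntegrable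
          _ _) fun r _ => ?_
      calc |fderiv ℝ u (y + (r : ℂ) * v) v| = ‖fderiv ℝ u (y + (r : ℂ) * v) v‖ := (Real.norm_eq_abs _).symm
        _ ≤ ‖fderiv ℝ u (y + (r : ℂ) * v)‖ * ‖v‖ := ContinuousLinearMap.le_opNorm _ _
        _ = ‖fderiv ℝ u (y + (r : ℂ) * v)‖ := by rw [hv1, mul_one]
    -- as a lower Lebesgue integral over `(0, ℓ)`
    have hint : IntegrableOn (fun r : ℝ => ‖fderiv ℝ u (y + (r : ℂ) * v)‖) (Ioc 0 ℓ) volume :=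
      ((((hu.continuous_fderiv one_ne_zero).comp (by fun_prop : Continuous fun r : ℝ => y + (r : ℂ) * v)).norm).integrableOn_Icc).mono_set
        Ioc_subset_Icc_self
    have hlin : ‖u y‖ₑ ≤ ∫⁻ r in Ioo (0 : ℝ) ℓ, ‖fderiv ℝ u (y + (r : ℂ) * v)‖ₑ := by
      rw [Real.enorm_eq_ofReal_abs]
      refine (ENNReal.ofReal_le_ofReal habs).trans ?_
      rw [intervalIntegral.integral_of_le hℓ0.le, ofReal_integral_eq_lintegral_ofReal hint
        (ae_restrict_of_forall_mem measurableSet_Ioc fun r _ => norm_nonneg _), setLIntegral_congr Ioo_ae_eq_Ioc.symm]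
      refine le_of_eq (lintegral_congr fun r => ?_)
      rw [ofReal_norm]
    -- the ray stays in the box before reaching the axis
    have hin : ∀ r ∈ Ioo (0 : ℝ) ℓ, y + (r : ℂ) * v ∈ Box := by
      intro r hr
      have hr0 : 0 < r := hr.1
      have hrℓ : r < ℓ := hr.2
      have hre : (y + (r : ℂ) * v).re = y.re + r * Real.cos θ := by
        simp [hv, Complex.cos_ofReal_re, Complex.sin_ofReal_re, Complex.cos_ofReal_im, Complex.sin_ofReal_im]
      have him : (y + (r : ℂ) * v).im = y.im + r * Real.sin θ := by
        simp [hv, Complex.cos_ofReal_re, Complex.sin_ofReal_re, Complex.cos_ofReal_im, Complex.sin_ofReal_im]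
      have hrc : |r * Real.cos θ| ≤ A := by
        rw [abs_mul, abs_of_pos hr0]
        nlinarith [abs_nonneg (Real.cos θ)]
      have hyre := abs_le.1 hy1
      have hrc' := abs_le.1 hrc
      have hℓs : ℓ * (-Real.sin θ) = y.im := by rw [hℓ]; field_simp
      refine ⟨⟨by rw [hre]; linarith, by rw [hre]; linarith⟩, ?_, ?_⟩
      · rw [him]
        nlinarith
      · rw [him]
        nlinarith
    calc ‖u y‖ₑ ≤ ∫⁻ r in Ioo (0 : ℝ) ℓ, ‖fderiv ℝ u (y + (r : ℂ) * v)‖ₑ := hlin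
      _ = ∫⁻ r in Ioo (0 : ℝ) ℓ, G (r, θ) := by
          refine setLIntegral_congr_fun measurableSet_Ioo fun r hr => ?_
          rw [hG]
          beta_reduce
          rw [hH, indicator_of_mem (hin r hr)]
      _ ≤ ∫⁻ r in Ioi (0 : ℝ), G (r, θ) := lintegral_mono_set fun r hr => hr.1
  -- step 2: average over the fan and pass to polar coordinates about `y`
  have harc : volume (Ioo (-(2 * π / 3)) (-(π / 3))) = ENNReal.ofReal (π / 3) := by
    rw [Real.volume_Ioo]; congr 1; ring
  have hsub : Ioo (-(2 * π / 3)) (-(π / 3)) ⊆ Ioo (-π) π := by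
    intro θ hθ
    exact ⟨by linarith [hθ.1, Real.pi_pos], by linarith [hθ.2, Real.pi_pos]⟩
  calc ENNReal.ofReal (π / 3) * ‖u y‖ₑ = ∫⁻ _ in Ioo (-(2 * π / 3)) (-(π / 3)), ‖u y‖ₑ := by
        rw [setLIntegral_const, harc, mul_comm]
    _ ≤ ∫⁻ θ in Ioo (-(2 * π / 3)) (-(π / 3)), ∫⁻ r in Ioi (0 : ℝ), G (r, θ) := setLIntegral_mono' measurableSet_Ioo hray
    _ ≤ ∫⁻ θ in Ioo (-π) π, ∫⁻ r in Ioi (0 : ℝ), G (r, θ) := lintegral_mono_set hsub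
    _ = ∫⁻ p in Ioi (0 : ℝ) ×ˢ Ioo (-π) π, G p := by
        have hμ : ((volume : Measure ℝ).restrict (Ioi 0)).prod ((volume : Measure ℝ).restrict (Ioo (-π) π)) =
            (volume : Measure (ℝ × ℝ)).restrict (Ioi (0 : ℝ) ×ˢ Ioo (-π) π) := by
          rw [Measure.prod_restrict, ← Measure.volume_eq_prod]
        rw [← hμ, lintegral_prod_symm _ hGm.aemeasurable]
    _ = ∫⁻ p in polarCoord.target, ENNReal.ofReal p.1 •
          ((fun x : ℂ => H (y + x) * ENNReal.ofReal ‖x‖⁻¹) (Complex.polarCoord.symm p)) := by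
        rw [show (polarCoord.target : Set (ℝ × ℝ)) = Ioi (0 : ℝ) ×ˢ Ioo (-π) π from rfl]
        refine setLIntegral_congr_fun (measurableSet_Ioi.prod measurableSet_Ioo) fun p hp => ?_
        have hp1 : 0 < p.1 := hp.1
        have hnorm : ‖Complex.polarCoord.symm p‖ = p.1 := by
          rw [Complex.norm_polarCoord_symm, abs_of_pos hp1]
        show G p = ENNReal.ofReal p.1 • (H (y + Complex.polarCoord.symm p) * ENNReal.ofReal ‖Complex.polarCoord.symm p‖⁻¹)
        rw [hnorm, smul_eq_mul, Complex.polarCoord_symm_apply, hG]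
        rw [mul_comm (ENNReal.ofReal p.1), mul_assoc, ← ENNReal.ofReal_mul (inv_nonneg.2 hp1.le), inv_mul_cancel₀ hp1.ne',
          ENNReal.ofReal_one, mul_one]
    _ = ∫⁻ x, H (y + x) * ENNReal.ofReal ‖x‖⁻¹ :=
        Complex.lintegral_comp_polarCoord_symm (fun x : ℂ => H (y + x) * ENNReal.ofReal ‖x‖⁻¹)
    _ = ∫⁻ x, H x * ENNReal.ofReal ‖x - y‖⁻¹ := by
        rw [← lintegral_add_right_eq_self (μ := (volume : Measure ℂ)) (fun x => H x * ENNReal.ofReal ‖x - y‖⁻¹) y]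
        refine lintegral_congr fun x => ?_
        simp only [add_sub_cancel_left, add_comm x y]
    _ = ∫⁻ x in Box, ‖fderiv ℝ u x‖ₑ * ENNReal.ofReal ‖x - y‖⁻¹ := by
        rw [← lintegral_indicator hBoxm]
        refine lintegral_congr fun x => ?_
        by_cases hx : x ∈ Box
        · rw [hH, indicator_of_mem hx, indicator_of_mem hx]
        · rw [hH, indicator_of_notMem hx, indicator_of_notMem hx, zero_mul]


/-! ### The axis capacity floor (registered log-sharp form) -/

/-- **THE AXIS CAPACITY FLOOR — `AxisCapacityFloor` of line `swirl-capacity`, the REGISTERED statement of stub D2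
(`Sig.stub_axisCapacityFloor`), with `K = π² / (18 (3 + log (512 π²)))`.**  An axisymmetric `C¹` scalar `f` on `ℝ³` vanishing on the
symmetry axis, `≥ γ₀ > 0` on a measurable `T ⊆ B(0,A)` of volume `≥ V > 0`, has
`∫_{B(0,3A)} ‖∇f‖² / r² ≥ K γ₀² / (A (1 + log⁺ (A³/V)))`.  [folklore] -/
theorem axisCapacityFloor :
    ∃ K : ℝ, 0 < K ∧ ∀ (f : EuclideanSpace ℝ (Fin 3) → ℝ) (T : Set (EuclideanSpace ℝ (Fin 3))) (A V γ₀ : ℝ),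
      ContDiff ℝ 1 f → IsAxisymmetricScalar f →
      (∀ x : EuclideanSpace ℝ (Fin 3), cylRadius x = 0 → f x = 0) → 0 < A → 0 < V → 0 < γ₀ → MeasurableSet T →
      T ⊆ ball (0 : EuclideanSpace ℝ (Fin 3)) A →
      ENNReal.ofReal V ≤ volume T → (∀ x ∈ T, γ₀ ≤ f x) →
        ENNReal.ofReal (K * γ₀ ^ 2 / (A * (1 + max 0 (Real.log (A ^ 3 / V))))) ≤
          ∫⁻ x in ball (0 : EuclideanSpace ℝ (Fin 3)) (3 * A), ENNReal.ofReal (‖fderiv ℝ f x‖ ^ 2 / cylRadius x ^ 2) := by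
  -- the universal constant
  set c₀ : ℝ := 3 + Real.log (512 * π ^ 2) with hc₀
  have hlog512 : 0 ≤ Real.log (512 * π ^ 2) := Real.log_nonneg (by nlinarith [Real.pi_gt_three])
  have hc₀1 : 1 ≤ c₀ := by rw [hc₀]; linarith
  have hc₀0 : 0 < c₀ := by linarith
  refine ⟨π ^ 2 / (18 * c₀), by positivity, ?_⟩
  intro f T A V γ₀ hf hax h0 hA hV hγ _hTm hTA hvol hlev
  -- the meridional embedding `M w = (im w, 0, re w)`
  set M : ℂ →L[ℝ] EuclideanSpace ℝ (Fin 3) :=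
    Complex.imCLM.smulRight (EuclideanSpace.single 0 (1 : ℝ)) + Complex.reCLM.smulRight (EuclideanSpace.single 2 (1 : ℝ)) with hMdef
  have hMapply : ∀ w : ℂ, M w = WithLp.toLp 2 ![w.im, 0, w.re] := by
    intro w
    ext i
    fin_cases i <;> simp [hMdef]
  have hMnorm : ∀ w : ℂ, ‖M w‖ = ‖w‖ := by
    intro w
    rw [hMapply, EuclideanSpace.norm_eq, Complex.norm_eq_sqrt_sq_add_sq, Fin.sum_univ_three]
    simp only [Real.norm_eq_abs, sq_abs]
    congr 1
    simp
    ring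
  have hMop : ‖M‖ ≤ 1 := ContinuousLinearMap.opNorm_le_bound _ zero_le_one fun w => by rw [hMnorm, one_mul]
  -- the meridional profile `u = f ∘ M`
  set u : ℂ → ℝ := fun w => f (M w) with hudef
  have hu : ContDiff ℝ 1 u := hf.comp M.contDiff
  have hufd : ∀ w : ℂ, ‖fderiv ℝ u w‖ ≤ ‖fderiv ℝ f (M w)‖ := by
    intro w
    have h := ((hf.differentiable one_ne_zero) (M w)).hasFDerivAt.comp w M.hasFDerivAt
    rw [show u = f ∘ M from rfl, h.fderiv]
    calc ‖(fderiv ℝ f (M w)).comp M‖ ≤ ‖fderiv ℝ f (M w)‖ * ‖M‖ := ContinuousLinearMap.opNorm_comp_le _ _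
      _ ≤ ‖fderiv ℝ f (M w)‖ * 1 := by gcongr
      _ = ‖fderiv ℝ f (M w)‖ := mul_one _
  have huax : ∀ w : ℂ, w.im = 0 → u w = 0 := by
    intro w hw
    apply h0
    rw [hMapply, cylRadius]
    simp [hw]
  -- the box and the section
  set Box : Set ℂ := {x : ℂ | x.re ∈ Icc (-(2 * A)) (2 * A) ∧ x.im ∈ Ioc 0 (2 * A)} with hBox
  set S' : Set ℂ := {w : ℂ | (w.re ∈ Icc (-A) A ∧ w.im ∈ Ioc 0 A) ∧ γ₀ ≤ u w} with hS'
  have hS'm : MeasurableSet S' :=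
    ((measurableSet_Icc.preimage Complex.continuous_re.measurable).inter
      (measurableSet_Ioc.preimage Complex.continuous_im.measurable)).inter (isClosed_le continuous_const hu.continuous).measurableSet
  have hS'B : S' ⊆ Box := by
    rintro w ⟨⟨⟨h1, h2⟩, h3, h4⟩, -⟩
    exact ⟨⟨by linarith, by linarith⟩, h3, by linarith⟩
  have hBR : Box ⊆ closedBall (0 : ℂ) (4 * A) := by
    rintro w ⟨⟨h1, h2⟩, h3, h4⟩
    rw [mem_closedBall, dist_zero_right]
    have hre : |w.re| ≤ 2 * A := abs_le.2 ⟨h1, h2⟩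
    have him : |w.im| ≤ 2 * A := abs_le.2 ⟨by linarith, h4⟩
    linarith [Complex.norm_le_abs_re_add_abs_im w]
  -- the coordinate equivalence `ℂ ≃ ℝ × ℝ`
  have hvp := Complex.volume_preserving_equiv_real_prod
  have hmerid : Continuous fun y : ℝ × ℝ => (WithLp.toLp 2 ![y.2, 0, y.1] : EuclideanSpace ℝ (Fin 3)) := by
    refine (PiLp.continuous_toLp 2 _).comp (continuous_pi fun i => ?_)
    fin_cases i
    · exact continuous_snd
    · exact continuous_const
    · exact continuous_fst
  -- (1) the area of the section: `|S'| ≥ V/(2πA)`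
  set Sec : Set (ℝ × ℝ) := {y : ℝ × ℝ | y ∈ Icc (-A) A ×ˢ Ioc (0 : ℝ) A ∧ γ₀ ≤ f (WithLp.toLp 2 ![y.2, 0, y.1])} with hSec
  have hSecm : MeasurableSet Sec :=
    (measurableSet_Icc.prod measurableSet_Ioc).inter (isClosed_le continuous_const (hf.continuous.comp hmerid)).measurableSet
  have hpre : Complex.measurableEquivRealProd ⁻¹' Sec = S' := by
    ext w
    simp only [hSec, hS', mem_preimage, Complex.measurableEquivRealProd_apply, mem_setOf_eq, mem_prod, hudef, hMapply]
  have hvolS' : ENNReal.ofReal (V / (2 * π * A)) ≤ volume S' := by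
    have h1 : volume T ≤ ENNReal.ofReal (2 * π * A) * volume Sec :=
      volume_le_meridional_section hax hf.continuous hA hTA hlev
    have h2 : volume S' = volume Sec := by
      rw [← hpre]; exact hvp.measure_preimage hSecm.nullMeasurableSet
    rw [ENNReal.ofReal_div_of_pos (by positivity), h2]
    exact ENNReal.div_le_of_le_mul' (hvol.trans h1)
  -- (2) the energy of the profile on the box: `E ≥ (π/A) ∫_Box ‖∇u‖²`
  set Ebox : ℝ≥0∞ := ∫⁻ w in Box, ‖fderiv ℝ u w‖ₑ ^ 2 with hEbox
  have henergy : ENNReal.ofReal (2 * π) * (ENNReal.ofReal (2 * A)⁻¹ * Ebox) ≤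
      ∫⁻ x in ball (0 : EuclideanSpace ℝ (Fin 3)) (3 * A), ENNReal.ofReal (‖fderiv ℝ f x‖ ^ 2 / cylRadius x ^ 2) := by
    refine le_trans ?_ (meridional_energy_le hax hf hA)
    gcongr
    -- transfer to `ℂ` and compare integrands on the box
    set F : ℝ × ℝ → ℝ≥0∞ := fun y => ENNReal.ofReal (‖fderiv ℝ f (WithLp.toLp 2 ![y.2, 0, y.1])‖ ^ 2 / y.2) with hF
    have hFm : Measurable F :=
      ENNReal.measurable_ofReal.comp ((((hf.continuous_fderiv one_ne_zero).comp hmerid).norm.pow 2).measurable.div measurable_snd)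
    have hpreR : Complex.measurableEquivRealProd ⁻¹' (Icc (-(2 * A)) (2 * A) ×ˢ Ioc (0 : ℝ) (2 * A)) = Box := by
      ext w
      simp only [hBox, mem_preimage, Complex.measurableEquivRealProd_apply, mem_setOf_eq, mem_prod]
    have htr : ∫⁻ y in Icc (-(2 * A)) (2 * A) ×ˢ Ioc (0 : ℝ) (2 * A), F y = ∫⁻ w in Box, F (Complex.measurableEquivRealProd w) := by
      rw [← hpreR]
      exact (hvp.setLIntegral_comp_preimage (measurableSet_Icc.prod measurableSet_Ioc) hFm).symm
    have hBoxm : MeasurableSet Box :=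
      (measurableSet_Icc.preimage Complex.continuous_re.measurable).inter (measurableSet_Ioc.preimage Complex.continuous_im.measurable)
    rw [htr, hEbox, ← lintegral_const_mul' _ _ ENNReal.ofReal_ne_top]
    refine setLIntegral_mono' hBoxm fun w hw => ?_
    have hw0 : 0 < w.im := hw.2.1
    have hw2 : w.im ≤ 2 * A := hw.2.2
    rw [hF]
    beta_reduce
    rw [Complex.measurableEquivRealProd_apply]
    show ENNReal.ofReal (2 * A)⁻¹ * ‖fderiv ℝ u w‖ₑ ^ 2 ≤ ENNReal.ofReal (‖fderiv ℝ f (WithLp.toLp 2 ![w.im, 0, w.re])‖ ^ 2 / w.im)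
    rw [← hMapply, ← ofReal_norm, ← ENNReal.ofReal_pow (norm_nonneg _), ← ENNReal.ofReal_mul (by positivity)]
    refine ENNReal.ofReal_le_ofReal ?_
    have h1 : ‖fderiv ℝ u w‖ ^ 2 ≤ ‖fderiv ℝ f (M w)‖ ^ 2 := pow_le_pow_left₀ (norm_nonneg _) (hufd w) 2
    calc (2 * A)⁻¹ * ‖fderiv ℝ u w‖ ^ 2 ≤ (w.im)⁻¹ * ‖fderiv ℝ f (M w)‖ ^ 2 := by
          gcongr
      _ = ‖fderiv ℝ f (M w)‖ ^ 2 / w.im := by rw [div_eq_inv_mul]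
  -- (3) the planar capacity inequality on the box
  have hray : ∀ y ∈ S', ENNReal.ofReal (π * γ₀ / 3) ≤ ∫⁻ x in Box, ‖fderiv ℝ u x‖ₑ * ENNReal.ofReal ‖x - y‖⁻¹ := by
    rintro y ⟨⟨⟨h1, h2⟩, h3, h4⟩, hγy⟩
    have hsec := sector_ray_bound hu huax hA (abs_le.2 ⟨h1, h2⟩) h3 h4
    refine le_trans ?_ hsec
    rw [show π * γ₀ / 3 = π / 3 * γ₀ by ring, ENNReal.ofReal_mul (by positivity)]
    gcongr
    rw [Real.enorm_eq_ofReal_abs]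
    exact ENNReal.ofReal_le_ofReal (hγy.trans (le_abs_self _))
  have hcap := lintegral_sq_ge_of_ray_bound (R := 4 * A) (c := π * γ₀ / 3) (L := V / (2 * π * A)) (by positivity) (by positivity)
    (by positivity) hS'm hS'B hBR (hu.continuous_fderiv one_ne_zero).measurable.enorm hray hvolS'
  -- (4) the logarithm bookkeeping
  obtain ⟨hS'fin, hmS'⟩ := volume_toReal_le_of_subset_closedBall (by positivity : (0 : ℝ) < 4 * A) (hS'B.trans hBR)
  have hLm : V / (2 * π * A) ≤ π * (4 * A) ^ 2 := by
    have := ENNReal.toReal_mono hS'fin hvolS'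
    rw [ENNReal.toReal_ofReal (by positivity)] at this
    exact this.trans hmS'
  have hratio : 16 ≤ 512 * π ^ 2 * (A ^ 3 / V) := by
    rw [div_le_iff₀ (by positivity)] at hLm
    have : V ≤ 32 * π ^ 2 * A ^ 3 := by nlinarith
    rw [show 512 * π ^ 2 * (A ^ 3 / V) = (512 * π ^ 2 * A ^ 3) / V by ring, le_div_iff₀ hV]
    nlinarith
  have hAV : 0 < A ^ 3 / V := by positivity
  have hℓ : Real.log (16 * π * (4 * A) ^ 2 / (V / (2 * π * A))) = Real.log (512 * π ^ 2) + Real.log (A ^ 3 / V) := by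
    rw [← Real.log_mul (by positivity) hAV.ne']
    congr 1
    field_simp
    ring
  have hℓpos : 0 < 3 + (Real.log (512 * π ^ 2) + Real.log (A ^ 3 / V)) := by
    have : Real.log 16 ≤ Real.log (512 * π ^ 2) + Real.log (A ^ 3 / V) := by
      rw [← Real.log_mul (by positivity) hAV.ne']
      exact Real.log_le_log (by norm_num) hratio
    have h16 : 0 < Real.log 16 := Real.log_pos (by norm_num)
    linarith
  have hden : 3 + (Real.log (512 * π ^ 2) + Real.log (A ^ 3 / V)) ≤ c₀ * (1 + max 0 (Real.log (A ^ 3 / V))) := by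
    have h1 : Real.log (A ^ 3 / V) ≤ max 0 (Real.log (A ^ 3 / V)) := le_max_right _ _
    have h2 : 0 ≤ max 0 (Real.log (A ^ 3 / V)) := le_max_left _ _
    rw [hc₀]
    nlinarith
  -- assemble
  have hcap' : ENNReal.ofReal ((π * γ₀ / 3) ^ 2 / (2 * π * (3 + (Real.log (512 * π ^ 2) + Real.log (A ^ 3 / V))))) ≤ Ebox := by
    rw [← hℓ]; exact hcap
  have hpos : 0 < 1 + max 0 (Real.log (A ^ 3 / V)) := by
    have := le_max_left 0 (Real.log (A ^ 3 / V)); linarith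
  -- `K γ₀² / (A (1 + log⁺)) ≤ 2π · (2A)⁻¹ · (πγ₀/3)² / (2π (3+ℓ))`  ⟸  `3 + ℓ ≤ c₀ (1 + log⁺)`
  have key : π ^ 2 / (18 * c₀) * γ₀ ^ 2 * (3 + (Real.log (512 * π ^ 2) + Real.log (A ^ 3 / V))) ≤
      π ^ 2 / 18 * γ₀ ^ 2 * (1 + max 0 (Real.log (A ^ 3 / V))) := by
    rw [show π ^ 2 / (18 * c₀) * γ₀ ^ 2 * (3 + (Real.log (512 * π ^ 2) + Real.log (A ^ 3 / V))) =
      π ^ 2 / 18 * γ₀ ^ 2 * ((3 + (Real.log (512 * π ^ 2) + Real.log (A ^ 3 / V))) / c₀) by field_simp]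
    gcongr
    rw [div_le_iff₀ hc₀0]
    linarith
  have hreal : π ^ 2 / (18 * c₀) * γ₀ ^ 2 / (A * (1 + max 0 (Real.log (A ^ 3 / V)))) ≤
      2 * π * ((2 * A)⁻¹ * ((π * γ₀ / 3) ^ 2 / (2 * π * (3 + (Real.log (512 * π ^ 2) + Real.log (A ^ 3 / V)))))) := by
    rw [div_le_iff₀ (by positivity)]
    calc π ^ 2 / (18 * c₀) * γ₀ ^ 2
        = π ^ 2 / (18 * c₀) * γ₀ ^ 2 * (3 + (Real.log (512 * π ^ 2) + Real.log (A ^ 3 / V))) /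
            (3 + (Real.log (512 * π ^ 2) + Real.log (A ^ 3 / V))) := by rw [mul_div_assoc, div_self hℓpos.ne', mul_one]
      _ ≤ π ^ 2 / 18 * γ₀ ^ 2 * (1 + max 0 (Real.log (A ^ 3 / V))) / (3 + (Real.log (512 * π ^ 2) + Real.log (A ^ 3 / V))) := by
          gcongr
      _ = 2 * π * ((2 * A)⁻¹ * ((π * γ₀ / 3) ^ 2 / (2 * π * (3 + (Real.log (512 * π ^ 2) + Real.log (A ^ 3 / V)))))) *
            (A * (1 + max 0 (Real.log (A ^ 3 / V)))) := by
          field_simp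
          ring
  calc ENNReal.ofReal (π ^ 2 / (18 * c₀) * γ₀ ^ 2 / (A * (1 + max 0 (Real.log (A ^ 3 / V)))))
      ≤ ENNReal.ofReal (2 * π * ((2 * A)⁻¹ *
          ((π * γ₀ / 3) ^ 2 / (2 * π * (3 + (Real.log (512 * π ^ 2) + Real.log (A ^ 3 / V))))))) := ENNReal.ofReal_le_ofReal hreal
    _ = ENNReal.ofReal (2 * π) * (ENNReal.ofReal (2 * A)⁻¹ *
          ENNReal.ofReal ((π * γ₀ / 3) ^ 2 / (2 * π * (3 + (Real.log (512 * π ^ 2) + Real.log (A ^ 3 / V)))))) := by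
        rw [← ENNReal.ofReal_mul (by positivity), ← ENNReal.ofReal_mul (by positivity)]
    _ ≤ ENNReal.ofReal (2 * π) * (ENNReal.ofReal (2 * A)⁻¹ * Ebox) := by gcongr
    _ ≤ ∫⁻ x in ball (0 : EuclideanSpace ℝ (Fin 3)) (3 * A), ENNReal.ofReal (‖fderiv ℝ f x‖ ^ 2 / cylRadius x ^ 2) := henergy

end Summit.NavierStokesRegularity.NavierStokesRegularity.Theorems.PowerGaugeEulerLiouville.SwirlCapacity

end
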